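import Mathlib

/-!
# T5EquivariantDescent — the «forms ↔ functions» dictionary of N1 ID-4(a), group-theoretic skeleton

Blind cell `pub-hodge-repro2`, Tier-5 support for sub-step N1 (route/T5-ID-p2.md, Theorem ID(iv)):
«Under Borel–Wallach's isomorphism A^•(Γ\𝔹²) ≅ C^•(𝔤, K; C^∞(Γ\G)), a holomorphic 1-form is a
K-equivariant function F : Γ\G → (𝔭⁺)^*, and the wedge of two holomorphic 1-forms is the pointwise
exterior product F ∧ F′ : Γ\G → ∧²(𝔭⁺)^*.»

This file formalises the SET-THEORETIC / LINEAR-ALGEBRAIC skeleton of the first half of that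
dictionary, for an arbitrary group `G`, a subgroup `Γ` (the lattice), a subgroup `K` (the maximal
compact) and a representation `ρ : Representation R K V` (the coefficient module, e.g. `(𝔭⁺)^*`):

* §1 the right translation action of `G` on the right coset space `Γ\G`
  (`Quotient (QuotientGroup.rightRel Γ)`), `rmul`;
* §2 left-`Γ`-invariant functions `G → V` descend to functions `Γ\G → V` — a linear equivalence
  `descendEquiv : leftInvariant Γ R ≃ₗ[R] (Γ\G → V)`;
* §3 right-`K`-equivariance (`f (g k) = ρ k⁻¹ (f g)`) is preserved and reflected by the descent:
  `descendEquivariantEquiv : (leftInvariant ⊓ rightEquivariant) ≃ₗ[R] rightEquivariantQuot`.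

The second half (the pointwise wedge and the trivial-coefficient case `Γ\G/K`) is
`T5EquivariantWedge.lean`. What stays prose: the differential geometry (smoothness, the
identification of the cotangent space of `G/K` at the base point with `𝔭^*`, holomorphy ↔
annihilation by `𝔭⁻`), i.e. everything in Borel–Wallach's isomorphism beyond its underlying
dictionary of functions.
-/
namespace Summit.Ventures.HodgeRepro2.T5EquivariantDescent

open QuotientGroup

section RightQuotient

variable {G : Type*} [Group G] (Γ : Subgroup G)

/-- The right coset space `Γ\G` (Mathlib's `QuotientGroup.rightRel`). -/
abbrev RightQuot : Type _ := Quotient (QuotientGroup.rightRel Γ)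

/-- The class `Γ g` of `g` in `Γ\G`. -/
abbrev mk (g : G) : RightQuot Γ := Quotient.mk'' g

/-- Two elements give the same right coset iff they differ by an element of `Γ` on the left. -/
theorem mk_eq_mk_iff {g g' : G} : mk Γ g = mk Γ g' ↔ g' * g⁻¹ ∈ Γ := by
  rw [Quotient.eq'']
  exact QuotientGroup.rightRel_apply

/-- Left multiplication by an element of `Γ` does not change the right coset. -/
theorem mk_mul_of_mem {γ : G} (hγ : γ ∈ Γ) (g : G) : mk Γ (γ * g) = mk Γ g := by
  rw [mk_eq_mk_iff]
  simpa using Γ.inv_mem hγ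

/-- Every right coset is `Γ g` for some `g`. -/
theorem mk_surjective : Function.Surjective (mk Γ) := Quotient.mk''_surjective

/-- Right translation `Γ g ↦ Γ (g h)` on `Γ\G`: well defined because left cosets of `Γ` and right
multiplication commute. -/
def rmul (x : RightQuot Γ) (h : G) : RightQuot Γ :=
  Quotient.liftOn' x (fun g => mk Γ (g * h)) (by
    intro a b hab
    rw [QuotientGroup.rightRel_apply] at hab
    rw [mk_eq_mk_iff]
    simpa [mul_assoc] using hab)

/-- Right translation on classes: `Γ g · h = Γ (g h)`. -/
@[simp] theorem rmul_mk (g h : G) : rmul Γ (mk Γ g) h = mk Γ (g * h) := rfl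

/-- Right translation by `1` is the identity. -/
theorem rmul_one (x : RightQuot Γ) : rmul Γ x 1 = x := by
  induction x using Quotient.inductionOn' with
  | h g => simp

/-- Right translation is an action: `(x · h) · h′ = x · (h h′)`. -/
theorem rmul_mul (x : RightQuot Γ) (h h' : G) : rmul Γ (rmul Γ x h) h' = rmul Γ x (h * h') := by
  induction x using Quotient.inductionOn' with
  | h g => simp [mul_assoc]

/-- Right translation by any `h` is onto. -/
theorem rmul_surjective (h : G) : Function.Surjective (fun x => rmul Γ x h) := by
  intro y
  induction y using Quotient.inductionOn' with
  | h g => exact ⟨mk Γ (g * h⁻¹), by simp⟩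

end RightQuotient

section Descent

variable {G : Type*} [Group G] (Γ : Subgroup G)
variable (R : Type*) [Semiring R] {V : Type*} [AddCommMonoid V] [Module R V]

/-- A function `G → V` is left-`Γ`-invariant: `f (γ g) = f g` for `γ ∈ Γ`. -/
def IsLeftInvariant (f : G → V) : Prop := ∀ γ ∈ Γ, ∀ g : G, f (γ * g) = f g

/-- The left-`Γ`-invariant functions form a submodule of `G → V`. -/
def leftInvariant : Submodule R (G → V) where
  carrier := {f | IsLeftInvariant Γ f}
  add_mem' := by
    intro f f' hf hf' γ hγ g
    simp only [Pi.add_apply, hf γ hγ g, hf' γ hγ g]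
  zero_mem' := by intro γ _ g; rfl
  smul_mem' := by
    intro r f hf γ hγ g
    simp only [Pi.smul_apply, hf γ hγ g]

/-- Membership in `leftInvariant` is left-`Γ`-invariance. -/
theorem mem_leftInvariant {f : G → V} : f ∈ leftInvariant Γ R ↔ IsLeftInvariant Γ f := Iff.rfl

variable {Γ} {R}

omit [AddCommMonoid V] in
/-- A left-`Γ`-invariant function is constant on right cosets. -/
theorem IsLeftInvariant.eq_of_rel {f : G → V} (hf : IsLeftInvariant Γ f) {a b : G}
    (hab : b * a⁻¹ ∈ Γ) : f a = f b := by
  have : b = (b * a⁻¹) * a := by group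
  rw [this, hf _ hab a]

variable (Γ) in
/-- The descent of a left-`Γ`-invariant function `f : G → V` to `Γ\G → V`. -/
def descend (f : G → V) (hf : IsLeftInvariant Γ f) : RightQuot Γ → V :=
  fun x => Quotient.liftOn' x f (fun a b hab => by
    rw [QuotientGroup.rightRel_apply] at hab
    exact hf.eq_of_rel hab)

omit [AddCommMonoid V] in
/-- The descent evaluated at the class of `g` is `f g`. -/
@[simp] theorem descend_mk {f : G → V} (hf : IsLeftInvariant Γ f) (g : G) :
    descend Γ f hf (mk Γ g) = f g := rfl

omit [AddCommMonoid V] in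
/-- `descend f ∘ mk = f`: the descent reproduces `f` on `G`. -/
theorem descend_comp_mk {f : G → V} (hf : IsLeftInvariant Γ f) :
    descend Γ f hf ∘ mk Γ = f := rfl

omit [AddCommMonoid V] in
variable (Γ) in
/-- Every function on `Γ\G` pulls back to a left-`Γ`-invariant function on `G`. -/
theorem isLeftInvariant_comp_mk (F : RightQuot Γ → V) : IsLeftInvariant Γ (F ∘ mk Γ) := by
  intro γ hγ g
  simp only [Function.comp_apply, mk_mul_of_mem Γ hγ g]

omit [AddCommMonoid V] in
/-- Descending the pull-back gives back the function on `Γ\G`. -/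
theorem descend_comp_mk_eq (F : RightQuot Γ → V) :
    descend Γ (F ∘ mk Γ) (isLeftInvariant_comp_mk Γ F) = F := by
  funext x
  induction x using Quotient.inductionOn' with
  | h g => rfl

omit [AddCommMonoid V] in
/-- The descent is injective on left-invariant functions. -/
theorem descend_injective {f f' : G → V} (hf : IsLeftInvariant Γ f) (hf' : IsLeftInvariant Γ f')
    (h : descend Γ f hf = descend Γ f' hf') : f = f' := by
  funext g
  have := congrFun h (mk Γ g)
  simpa using this

variable (Γ R) in
/-- **Descent as a linear equivalence**: left-`Γ`-invariant functions `G → V` are exactly the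
functions `Γ\G → V`. -/
def descendEquiv : (leftInvariant Γ R : Submodule R (G → V)) ≃ₗ[R] (RightQuot Γ → V) where
  toFun f := descend Γ f.1 f.2
  invFun F := ⟨F ∘ mk Γ, isLeftInvariant_comp_mk Γ F⟩
  left_inv f := by
    apply Subtype.ext
    exact descend_comp_mk f.2
  right_inv F := descend_comp_mk_eq F
  map_add' f f' := by
    funext x
    induction x using Quotient.inductionOn' with
    | h g => rfl
  map_smul' r f := by
    funext x
    induction x using Quotient.inductionOn' with
    | h g => rfl

/-- The forward map of `descendEquiv` is `descend`. -/
@[simp] theorem descendEquiv_apply (f : leftInvariant Γ R (V := V)) :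
    descendEquiv Γ R f = descend Γ f.1 f.2 := rfl

/-- The inverse map of `descendEquiv` is the pull-back along `mk`. -/
@[simp] theorem descendEquiv_symm_apply (F : RightQuot Γ → V) :
    ((descendEquiv Γ R).symm F : G → V) = F ∘ mk Γ := rfl

end Descent

section Equivariance

variable {G : Type*} [Group G] (Γ K : Subgroup G)
variable {R : Type*} [CommSemiring R] {V : Type*} [AddCommMonoid V] [Module R V]
variable (ρ : Representation R K V)

/-- A function `f : G → V` is right-`K`-equivariant for `ρ`: `f (g k) = ρ k⁻¹ (f g)` — the
transformation law of a `K`-equivariant function on `G` with values in the fibre `V` (here `V =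
(𝔭⁺)^*`, `ρ` the coadjoint action of `K`). -/
def IsRightEquivariant (f : G → V) : Prop := ∀ (g : G) (k : K), f (g * k) = ρ k⁻¹ (f g)

/-- The right-`K`-equivariant functions form a submodule of `G → V`. -/
def rightEquivariant : Submodule R (G → V) where
  carrier := {f | IsRightEquivariant K ρ f}
  add_mem' := by
    intro f f' hf hf' g k
    simp only [Pi.add_apply, hf g k, hf' g k, map_add]
  zero_mem' := by intro g k; simp
  smul_mem' := by
    intro r f hf g k
    simp only [Pi.smul_apply, hf g k, map_smul]

/-- Membership in `rightEquivariant` is right-`K`-equivariance. -/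
theorem mem_rightEquivariant {f : G → V} :
    f ∈ rightEquivariant K ρ ↔ IsRightEquivariant K ρ f := Iff.rfl

/-- The same transformation law for a function on `Γ\G`, with respect to the right translation
action `rmul`. -/
def IsRightEquivariantQuot (F : RightQuot Γ → V) : Prop :=
  ∀ (x : RightQuot Γ) (k : K), F (rmul Γ x k) = ρ k⁻¹ (F x)

/-- The right-`K`-equivariant functions on `Γ\G` form a submodule. -/
def rightEquivariantQuot : Submodule R (RightQuot Γ → V) where
  carrier := {F | IsRightEquivariantQuot Γ K ρ F}
  add_mem' := by
    intro F F' hF hF' x k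
    simp only [Pi.add_apply, hF x k, hF' x k, map_add]
  zero_mem' := by intro x k; simp
  smul_mem' := by
    intro r F hF x k
    simp only [Pi.smul_apply, hF x k, map_smul]

/-- Membership in `rightEquivariantQuot` is right-`K`-equivariance on `Γ\G`. -/
theorem mem_rightEquivariantQuot {F : RightQuot Γ → V} :
    F ∈ rightEquivariantQuot Γ K ρ ↔ IsRightEquivariantQuot Γ K ρ F := Iff.rfl

variable {Γ K ρ}

/-- The descent of a left-invariant function is right-`K`-equivariant iff the function is. -/
theorem isRightEquivariantQuot_descend_iff {f : G → V} (hf : IsLeftInvariant Γ f) :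
    IsRightEquivariantQuot Γ K ρ (descend Γ f hf) ↔ IsRightEquivariant K ρ f := by
  constructor
  · intro H g k
    have := H (mk Γ g) k
    simpa using this
  · intro H x k
    induction x using Quotient.inductionOn' with
    | h g => simpa using H g k

/-- The pull-back of a right-`K`-equivariant function on `Γ\G` is right-`K`-equivariant. -/
theorem isRightEquivariant_comp_mk {F : RightQuot Γ → V} (hF : IsRightEquivariantQuot Γ K ρ F) :
    IsRightEquivariant K ρ (F ∘ mk Γ) := by
  intro g k
  simpa using hF (mk Γ g) k

variable (Γ K ρ) in
/-- **The dictionary of N1 ID-4(a), skeleton**: left-`Γ`-invariant, right-`K`-equivariant functions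
`G → V` are exactly the right-`K`-equivariant functions `Γ\G → V` (a linear equivalence). -/
def descendEquivariantEquiv :
    ↥((leftInvariant Γ R : Submodule R (G → V)) ⊓ rightEquivariant K ρ) ≃ₗ[R]
      rightEquivariantQuot Γ K ρ where
  toFun f := ⟨descend Γ f.1 f.2.1, (isRightEquivariantQuot_descend_iff f.2.1).2 f.2.2⟩
  invFun F := ⟨F.1 ∘ mk Γ, isLeftInvariant_comp_mk Γ F.1, isRightEquivariant_comp_mk F.2⟩
  left_inv f := by
    apply Subtype.ext
    exact descend_comp_mk f.2.1
  right_inv F := by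
    apply Subtype.ext
    exact descend_comp_mk_eq F.1
  map_add' f f' := by
    apply Subtype.ext
    funext x
    induction x using Quotient.inductionOn' with
    | h g => rfl
  map_smul' r f := by
    apply Subtype.ext
    funext x
    induction x using Quotient.inductionOn' with
    | h g => rfl

/-- The forward map of `descendEquivariantEquiv` is `descend`. -/
@[simp] theorem descendEquivariantEquiv_apply_coe
    (f : ↥((leftInvariant Γ R : Submodule R (G → V)) ⊓ rightEquivariant K ρ)) :
    (descendEquivariantEquiv Γ K ρ f : RightQuot Γ → V) = descend Γ f.1 f.2.1 := rfl

/-- The inverse map of `descendEquivariantEquiv` is the pull-back along `mk`. -/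
@[simp] theorem descendEquivariantEquiv_symm_apply_coe (F : rightEquivariantQuot Γ K ρ) :
    ((descendEquivariantEquiv Γ K ρ).symm F : G → V) = F.1 ∘ mk Γ := rfl

end Equivariance

end Summit.Ventures.HodgeRepro2.T5EquivariantDescent
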